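import Summits.QuantumFields.BalabanUV.Beta.FP.NestedDressingHessian

/-!
# `BalabanUV.Beta.FP.GhostAwareStepLawHessian` — road «FP» for binder row D1, RULING R-FP-46 ∕ scope note S-FP-15-1, row **BORDER** at MODEL level (owner, gen 15):
# THE SECOND VARIATION OF THE GHOST-DRESSED STEP LAW WITH EVERYTHING MOVING — form `K(u)`, averagings `Q₁(u)`, `Q₂(u)`, null directions `W₁(u)`, `W₂(u)` —
# `secondVar 𝕂_N − secondVar 𝕂_F − secondVar 𝕂_B = 2·secondVar(P·W) − 2·secondVar(τ₁W₁) − 2·secondVar(τ₂Q₁W₂)`: the six-loop one shot IS fine + block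
# UP TO THE DISPLAYED SECOND VARIATIONS OF THE THREE LINEARISED FADDEEV–POPOV FACTORS (the ghost words); they vanish when the FP factors are static

HONEST DEPENDENCY (page 1, mandatory): continuum YM on T⁴ ⇐ BetaPertH ∧ nine spine estimates (0/9 proved); BetaPertH ⇐ (D1) ∧ (D4) ∧ CAP+tail;
G-an2-4 gates asym, D1 and NE2/3/4.  HONEST FRAMING (cell contract, verbatim): «discharging `BetaPertH` makes Bałaban's UV stability UNCONDITIONAL —
a real constructive-QFT result; it is NOT the continuum limit and NOT the Clay problem.»  THIS MODULE DISCHARGES NOTHING of the wall: [folklore] one-variable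
calculus of `log|det|` (six curves) over the owner's `ComposedSliceGhostFactor.log_abs_det_kkt_comp_ghostDressed` (gen 14; = an5's `det_kkt_comp_sliceChange`
with the Faddeev–Popov product factorised) and road BF-x's `LogDetSecondVariation` (`hasDerivAt_logAbsDet`, `hasDerivAt_trace_inv_mul`).  No `def`, no
`def … : Prop`, nothing cited, 0 sorry; 0∕4 row-D1 binders; NOT SDF, NOT D1, NOT BetaPertH, NOT continuum, NOT Clay.  «not in print; our bookkeeping».

ABSOLUTE RULE (cell charter, verbatim): «No internally-minted statement may enter as a cited fact. Every hypothesis is either kernel-proved in this package or a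
verbatim quotation of a PUBLISHED theorem with page reference. The manuscript(s) under audit are NOT citable for their own disputed steps — they are the thing
under adjudication; programme-internal (2001/route/tribunal) claims are never citable.»

WHY (scope note S-FP-15-1, journal l.34563).  The static-border oracle `NestedDressingHessian.secondVar_nestedStepLaw` certifies the nested step law for the FORM jets
(`Q̇ = Q̈ = 0`); the literal's `TP` carries BORDER jets (an1's border tables, leaf-02's composite constraint Hessians) — the full six loops of
`KKTSecondVariation.secondVar_kkt`.  The general det-level law holds at EVERY background with MOVING averagings and null directions, but its «constant» is the sum of
the three linearised Faddeev–Popov logarithms `2log|det P·[W₂|W₁]| − 2log|det τ₁W₁| − 2log|det τ₂·Q₁W₂|`, which then moves too.  THIS FILE differentiates that general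
law twice: the one shot's six-loop second variation equals the fine one plus the block one PLUS twice the second variations of the three FP factors, ALL DISPLAYED.
Row BORDER of R-FP-46 (B′) is thereby located EXACTLY: for the literal's group-mean slices the three ghost second variations must vanish ∕ cancel ((α-FP), an2's
R-D1-g25-3 «FP ≡ 1» at the linearised level) — or be carried ((C) of R-FP-45).

CONTENTS ([folklore]):
* §1 `secondVar_comb6_eq_zero` — six matrix curves whose weighted `log|det|`'s sum to a constant near `t` have the weighted sum of their `secondVar`'s equal to `0` at `t`
  (road BF-x's `secondVar_comb_eq_zero`, six slots).
* §2 **`secondVar_ghostDressedStepLaw`** — data: curves `K`, `Q₁`, `Q₂`, `W₁`, `W₂` (first jets near `0`, second jets at `0`), static slices `τ₁ τ₂ P`, and four DISPLAYED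
  companion curves agreeing near `0` with `Q₂·Q₁`, `Q₁·W₂`, `[W₂|W₁]` and the block form `(effForm K [Q₁;τ₁])₁₁` (pattern of the static oracle's `E`); the algebraic
  hypotheses of `det_kkt_comp_ghostDressed` ALONG THE CURVE (null directions two-sided, blindness) and non-degeneracy AT `0`.  Conclusion:
  `secondVar 𝕂_N − 2·secondVar (P·W) − secondVar 𝕂_F + 2·secondVar (τ₁W₁) − secondVar 𝕂_B + 2·secondVar (τ₂Q₁W₂) = 0` at `0`.
Provenance: road FP OWNER b2b-balaban-beta-d1-p3 gen 15 (prover-b2b-balaban-beta-d1-p3-g15-0), 2026-08-21; R-FP-46 (B′) row BORDER (model).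
-/

noncomputable section

namespace Summit.QuantumFields.BalabanUV.Beta.FP.GhostAwareStepLawHessian

open Matrix Filter Finset
open scoped Topology
open Literature.MathematicalPhysics.QuantumFieldTheory.Balaban1983to89.Beta.Composition (kkt)
open Literature.MathematicalPhysics.QuantumFieldTheory.Balaban1983to89.Beta.CompositionSingular (effForm)
open Literature.Analysis.Calculus (eventually_det_ne_zero)
open Summit.QuantumFields.BalabanUV.Beta.D1BFx.LogDetSecondVariation (secondVar hasDerivAt_logAbsDet hasDerivAt_trace_inv_mul)
open Summit.QuantumFields.BalabanUV.Beta.D1BFx.SliceTransferModel (hasDerivAt_kkt hasDerivAt_kkt_fromRows hasDerivAt_const_mul)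
open Summit.QuantumFields.BalabanUV.Beta.FP.ComposedSliceGhostFactor (log_abs_det_kkt_comp_ghostDressed det_kkt_oneShot_ne_zero)

/-! ## §1 Six curves: a constant combination of `log|det|` has zero combination of second variations -/

section Comb6

variable {ι₁ ι₂ ι₃ ι₄ ι₅ ι₆ : Type*} [Fintype ι₁] [DecidableEq ι₁] [Fintype ι₂] [DecidableEq ι₂] [Fintype ι₃] [DecidableEq ι₃]
  [Fintype ι₄] [DecidableEq ι₄] [Fintype ι₅] [DecidableEq ι₅] [Fintype ι₆] [DecidableEq ι₆]

/-- [folklore] **SIX-SLOT UNIQUENESS OF THE SECOND VARIATION**: six matrix curves, each with first derivatives near `t`, a second derivative at `t` and `det ≠ 0` at `t`;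
if `Σ aᵢ·log|det Aᵢ|` is CONSTANT near `t` then `Σ aᵢ·secondVar Aᵢ = 0` at `t` (road BF-x's `secondVar_comb_eq_zero`, two more slots). -/
theorem secondVar_comb6_eq_zero
    {A A₁ : ℝ → ι₁ → ι₁ → ℝ} {A₂ : Matrix ι₁ ι₁ ℝ} {B B₁ : ℝ → ι₂ → ι₂ → ℝ} {B₂ : Matrix ι₂ ι₂ ℝ}
    {C C₁ : ℝ → ι₃ → ι₃ → ℝ} {C₂ : Matrix ι₃ ι₃ ℝ} {D D₁ : ℝ → ι₄ → ι₄ → ℝ} {D₂ : Matrix ι₄ ι₄ ℝ}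
    {G G₁ : ℝ → ι₅ → ι₅ → ℝ} {G₂ : Matrix ι₅ ι₅ ℝ} {H H₁ : ℝ → ι₆ → ι₆ → ℝ} {H₂ : Matrix ι₆ ι₆ ℝ} {t a b c d g h k : ℝ}
    (hA : ∀ᶠ u in 𝓝 t, HasDerivAt A (A₁ u) u) (hA₁ : HasDerivAt A₁ (A₂ : ι₁ → ι₁ → ℝ) t) (hdA : (Matrix.of (A t)).det ≠ 0)
    (hB : ∀ᶠ u in 𝓝 t, HasDerivAt B (B₁ u) u) (hB₁ : HasDerivAt B₁ (B₂ : ι₂ → ι₂ → ℝ) t) (hdB : (Matrix.of (B t)).det ≠ 0)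
    (hC : ∀ᶠ u in 𝓝 t, HasDerivAt C (C₁ u) u) (hC₁ : HasDerivAt C₁ (C₂ : ι₃ → ι₃ → ℝ) t) (hdC : (Matrix.of (C t)).det ≠ 0)
    (hD : ∀ᶠ u in 𝓝 t, HasDerivAt D (D₁ u) u) (hD₁ : HasDerivAt D₁ (D₂ : ι₄ → ι₄ → ℝ) t) (hdD : (Matrix.of (D t)).det ≠ 0)
    (hG : ∀ᶠ u in 𝓝 t, HasDerivAt G (G₁ u) u) (hG₁ : HasDerivAt G₁ (G₂ : ι₅ → ι₅ → ℝ) t) (hdG : (Matrix.of (G t)).det ≠ 0)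
    (hH : ∀ᶠ u in 𝓝 t, HasDerivAt H (H₁ u) u) (hH₁ : HasDerivAt H₁ (H₂ : ι₆ → ι₆ → ℝ) t) (hdH : (Matrix.of (H t)).det ≠ 0)
    (heq : ∀ᶠ u in 𝓝 t, a * Real.log |(Matrix.of (A u)).det| + b * Real.log |(Matrix.of (B u)).det|
      + c * Real.log |(Matrix.of (C u)).det| + d * Real.log |(Matrix.of (D u)).det|
      + g * Real.log |(Matrix.of (G u)).det| + h * Real.log |(Matrix.of (H u)).det| = k) :
    a * secondVar (Matrix.of (A t)) (Matrix.of (A₁ t)) A₂ + b * secondVar (Matrix.of (B t)) (Matrix.of (B₁ t)) B₂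
      + c * secondVar (Matrix.of (C t)) (Matrix.of (C₁ t)) C₂ + d * secondVar (Matrix.of (D t)) (Matrix.of (D₁ t)) D₂
      + g * secondVar (Matrix.of (G t)) (Matrix.of (G₁ t)) G₂ + h * secondVar (Matrix.of (H t)) (Matrix.of (H₁ t)) H₂ = 0 := by
  have hAt : HasDerivAt A (A₁ t) t := hA.self_of_nhds
  have hBt : HasDerivAt B (B₁ t) t := hB.self_of_nhds
  have hCt : HasDerivAt C (C₁ t) t := hC.self_of_nhds
  have hDt : HasDerivAt D (D₁ t) t := hD.self_of_nhds
  have hGt : HasDerivAt G (G₁ t) t := hG.self_of_nhds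
  have hHt : HasDerivAt H (H₁ t) t := hH.self_of_nhds
  have hdA' : ∀ᶠ u in 𝓝 t, (Matrix.of (A u)).det ≠ 0 := eventually_det_ne_zero hAt.hasFDerivAt hdA
  have hdB' : ∀ᶠ u in 𝓝 t, (Matrix.of (B u)).det ≠ 0 := eventually_det_ne_zero hBt.hasFDerivAt hdB
  have hdC' : ∀ᶠ u in 𝓝 t, (Matrix.of (C u)).det ≠ 0 := eventually_det_ne_zero hCt.hasFDerivAt hdC
  have hdD' : ∀ᶠ u in 𝓝 t, (Matrix.of (D u)).det ≠ 0 := eventually_det_ne_zero hDt.hasFDerivAt hdD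
  have hdG' : ∀ᶠ u in 𝓝 t, (Matrix.of (G u)).det ≠ 0 := eventually_det_ne_zero hGt.hasFDerivAt hdG
  have hdH' : ∀ᶠ u in 𝓝 t, (Matrix.of (H u)).det ≠ 0 := eventually_det_ne_zero hHt.hasFDerivAt hdH
  set f : ℝ → ℝ := fun u => a * ((Matrix.of (A u))⁻¹ * Matrix.of (A₁ u)).trace + b * ((Matrix.of (B u))⁻¹ * Matrix.of (B₁ u)).trace
    + c * ((Matrix.of (C u))⁻¹ * Matrix.of (C₁ u)).trace + d * ((Matrix.of (D u))⁻¹ * Matrix.of (D₁ u)).trace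
    + g * ((Matrix.of (G u))⁻¹ * Matrix.of (G₁ u)).trace + h * ((Matrix.of (H u))⁻¹ * Matrix.of (H₁ u)).trace with hf
  have hfirst : ∀ᶠ u in 𝓝 t, f u = 0 := by
    have hev : ∀ᶠ u in 𝓝 t, ∀ᶠ v in 𝓝 u, a * Real.log |(Matrix.of (A v)).det| + b * Real.log |(Matrix.of (B v)).det|
        + c * Real.log |(Matrix.of (C v)).det| + d * Real.log |(Matrix.of (D v)).det|
        + g * Real.log |(Matrix.of (G v)).det| + h * Real.log |(Matrix.of (H v)).det| = k := heq.eventually_nhds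
    filter_upwards [hA, hB, hC, hD, hG, hH, hdA', hdB', hdC', hdD', hdG', hdH', hev]
      with u huA huB huC huD huG huH hduA hduB hduC hduD hduG hduH hequ
    have h1 := ((((((hasDerivAt_logAbsDet (A₁ := Matrix.of (A₁ u)) huA hduA).const_mul a).add
      ((hasDerivAt_logAbsDet (A₁ := Matrix.of (B₁ u)) huB hduB).const_mul b)).add
      ((hasDerivAt_logAbsDet (A₁ := Matrix.of (C₁ u)) huC hduC).const_mul c)).add
      ((hasDerivAt_logAbsDet (A₁ := Matrix.of (D₁ u)) huD hduD).const_mul d)).add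
      ((hasDerivAt_logAbsDet (A₁ := Matrix.of (G₁ u)) huG hduG).const_mul g)).add
      ((hasDerivAt_logAbsDet (A₁ := Matrix.of (H₁ u)) huH hduH).const_mul h)
    have h2 : HasDerivAt (fun v => a * Real.log |(Matrix.of (A v)).det| + b * Real.log |(Matrix.of (B v)).det|
        + c * Real.log |(Matrix.of (C v)).det| + d * Real.log |(Matrix.of (D v)).det|
        + g * Real.log |(Matrix.of (G v)).det| + h * Real.log |(Matrix.of (H v)).det|) 0 u :=
      (hasDerivAt_const u k).congr_of_eventuallyEq hequ
    have h3 := h1.unique h2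
    rw [hf]
    exact h3
  have hsecond : HasDerivAt f (a * secondVar (Matrix.of (A t)) (Matrix.of (A₁ t)) A₂ + b * secondVar (Matrix.of (B t)) (Matrix.of (B₁ t)) B₂
      + c * secondVar (Matrix.of (C t)) (Matrix.of (C₁ t)) C₂ + d * secondVar (Matrix.of (D t)) (Matrix.of (D₁ t)) D₂
      + g * secondVar (Matrix.of (G t)) (Matrix.of (G₁ t)) G₂ + h * secondVar (Matrix.of (H t)) (Matrix.of (H₁ t)) H₂) t := by
    rw [hf]
    exact ((((((hasDerivAt_trace_inv_mul hAt hA₁ hdA).const_mul a).add ((hasDerivAt_trace_inv_mul hBt hB₁ hdB).const_mul b)).add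
      ((hasDerivAt_trace_inv_mul hCt hC₁ hdC).const_mul c)).add ((hasDerivAt_trace_inv_mul hDt hD₁ hdD).const_mul d)).add
      ((hasDerivAt_trace_inv_mul hGt hG₁ hdG).const_mul g)).add ((hasDerivAt_trace_inv_mul hHt hH₁ hdH).const_mul h)
  have hzero : HasDerivAt f 0 t := (hasDerivAt_const t (0 : ℝ)).congr_of_eventuallyEq hfirst
  exact hsecond.unique hzero

end Comb6

/-! ## §2 The ghost-dressed step law, second variation, everything moving -/

section Moving

variable {ν μ κ ρ₁ ρ₂ : Type*} [Fintype ν] [Fintype μ] [Fintype κ] [Fintype ρ₁] [Fintype ρ₂]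
  [DecidableEq ν] [DecidableEq μ] [DecidableEq κ] [DecidableEq ρ₁] [DecidableEq ρ₂]

/-- [folklore] **THE SECOND VARIATION OF THE GHOST-DRESSED STEP LAW WITH MOVING FORM, AVERAGINGS AND NULL DIRECTIONS** (row BORDER at MODEL level).
Static slices `τ₁`, `τ₂`, `P`.  Curves with first jets near `0` and second jets at `0`: the fine form `K`, the fine averaging `Q` (= `Q₁`), the second averaging `R` (= `Q₂`),
the fine null directions `X` (= `W₁`), the composite ones `Y` (= `W₂`); DISPLAYED companion curves agreeing near `0` with the composite averaging `R·Q`, the descended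
directions `Q·Y`, the block of null directions `[Y|X]` and the block form `(effForm K [Q;τ₁])₁₁`.  Along the curve (near `0`): `K·X = 0`, `Kᵀ·X = 0`, `Q·X = 0`,
`K·Y = 0`, `Kᵀ·Y = 0`, `R·(Q·Y) = 0`; at `0`: the three FP matrices, the fine and the block bordered systems are non-degenerate.  CONCLUSION at `u = 0` (each `secondVar`
taken along its own curve with its own jets):
`secondVar 𝕂_N(K,[RQ;P]) − 2·secondVar (P·[Y|X]) − secondVar 𝕂_F(K,[Q;τ₁]) + 2·secondVar (τ₁·X) − secondVar 𝕂_B(E,[R;τ₂]) + 2·secondVar (τ₂·(Q·Y)) = 0` —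
the one shot's SIX-loop one-loop functional IS the fine one plus the block one up to (twice) the second variations of the three linearised Faddeev–Popov factors. -/
theorem secondVar_ghostDressedStepLaw (τ₁ : Matrix ρ₁ ν ℝ) (τ₂ : Matrix ρ₂ μ ℝ) (P : Matrix (ρ₂ ⊕ ρ₁) ν ℝ)
    -- the five honest curves
    {K K₁ : ℝ → ν → ν → ℝ} {K₂ : Matrix ν ν ℝ} (hK : ∀ᶠ u in 𝓝 (0 : ℝ), HasDerivAt K (K₁ u) u) (hK₁ : HasDerivAt K₁ (Matrix.of.symm K₂) 0)
    {Q Q' : ℝ → μ → ν → ℝ} {Q'' : Matrix μ ν ℝ} (hQ : ∀ᶠ u in 𝓝 (0 : ℝ), HasDerivAt Q (Q' u) u) (hQ' : HasDerivAt Q' (Matrix.of.symm Q'') 0)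
    {R R' : ℝ → κ → μ → ℝ} {R'' : Matrix κ μ ℝ} (hR : ∀ᶠ u in 𝓝 (0 : ℝ), HasDerivAt R (R' u) u) (hR' : HasDerivAt R' (Matrix.of.symm R'') 0)
    {X X' : ℝ → ν → ρ₁ → ℝ} {X'' : Matrix ν ρ₁ ℝ} (hX : ∀ᶠ u in 𝓝 (0 : ℝ), HasDerivAt X (X' u) u) (hX' : HasDerivAt X' (Matrix.of.symm X'') 0)
    {Y : ℝ → ν → ρ₂ → ℝ}
    -- the four displayed companions
    {NQ NQ' : ℝ → κ → ν → ℝ} {NQ'' : Matrix κ ν ℝ} (hNQ : ∀ᶠ u in 𝓝 (0 : ℝ), HasDerivAt NQ (NQ' u) u) (hNQ' : HasDerivAt NQ' (Matrix.of.symm NQ'') 0)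
    (hNQeq : ∀ᶠ u in 𝓝 (0 : ℝ), Matrix.of (NQ u) = Matrix.of (R u) * Matrix.of (Q u))
    {DW DW' : ℝ → μ → ρ₂ → ℝ} {DW'' : Matrix μ ρ₂ ℝ} (hDW : ∀ᶠ u in 𝓝 (0 : ℝ), HasDerivAt DW (DW' u) u) (hDW' : HasDerivAt DW' (Matrix.of.symm DW'') 0)
    (hDWeq : ∀ᶠ u in 𝓝 (0 : ℝ), Matrix.of (DW u) = Matrix.of (Q u) * Matrix.of (Y u))
    {Wc Wc' : ℝ → ν → (ρ₂ ⊕ ρ₁) → ℝ} {Wc'' : Matrix ν (ρ₂ ⊕ ρ₁) ℝ} (hWc : ∀ᶠ u in 𝓝 (0 : ℝ), HasDerivAt Wc (Wc' u) u)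
    (hWc' : HasDerivAt Wc' (Matrix.of.symm Wc'') 0) (hWceq : ∀ᶠ u in 𝓝 (0 : ℝ), Matrix.of (Wc u) = fromCols (Matrix.of (Y u)) (Matrix.of (X u)))
    {E E₁ : ℝ → μ → μ → ℝ} {E₂ : Matrix μ μ ℝ} (hE : ∀ᶠ u in 𝓝 (0 : ℝ), HasDerivAt E (E₁ u) u) (hE₁ : HasDerivAt E₁ (Matrix.of.symm E₂) 0)
    (hEeq : ∀ᶠ u in 𝓝 (0 : ℝ), Matrix.of (E u) = (effForm (Matrix.of (K u)) (fromRows (Matrix.of (Q u)) τ₁)).toBlocks₁₁)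
    -- the algebra of the composition along the curve
    (hKX : ∀ᶠ u in 𝓝 (0 : ℝ), Matrix.of (K u) * Matrix.of (X u) = 0) (hKtX : ∀ᶠ u in 𝓝 (0 : ℝ), (Matrix.of (K u))ᵀ * Matrix.of (X u) = 0)
    (hQX : ∀ᶠ u in 𝓝 (0 : ℝ), Matrix.of (Q u) * Matrix.of (X u) = 0)
    (hKY : ∀ᶠ u in 𝓝 (0 : ℝ), Matrix.of (K u) * Matrix.of (Y u) = 0) (hKtY : ∀ᶠ u in 𝓝 (0 : ℝ), (Matrix.of (K u))ᵀ * Matrix.of (Y u) = 0)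
    (hRQY : ∀ᶠ u in 𝓝 (0 : ℝ), Matrix.of (R u) * (Matrix.of (Q u) * Matrix.of (Y u)) = 0)
    -- the values of all curves and first jets at `0`, NAMED (instantiate with `rfl`)
    {K₀ K₁₀ : Matrix ν ν ℝ} (hK0 : Matrix.of (K 0) = K₀) (hK10 : Matrix.of (K₁ 0) = K₁₀)
    {Q₀ Q₁₀ : Matrix μ ν ℝ} (hQ0 : Matrix.of (Q 0) = Q₀) (hQ10 : Matrix.of (Q' 0) = Q₁₀)
    {R₀ R₁₀ : Matrix κ μ ℝ} (hR0 : Matrix.of (R 0) = R₀) (hR10 : Matrix.of (R' 0) = R₁₀)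
    {X₀ X₁₀ : Matrix ν ρ₁ ℝ} (hX0 : Matrix.of (X 0) = X₀) (hX10 : Matrix.of (X' 0) = X₁₀)
    {NQ₀ NQ₁₀ : Matrix κ ν ℝ} (hNQ0' : Matrix.of (NQ 0) = NQ₀) (hNQ10 : Matrix.of (NQ' 0) = NQ₁₀)
    {DW₀ DW₁₀ : Matrix μ ρ₂ ℝ} (hDW0' : Matrix.of (DW 0) = DW₀) (hDW10 : Matrix.of (DW' 0) = DW₁₀)
    {Wc₀ Wc₁₀ : Matrix ν (ρ₂ ⊕ ρ₁) ℝ} (hWc0' : Matrix.of (Wc 0) = Wc₀) (hWc10 : Matrix.of (Wc' 0) = Wc₁₀)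
    {E₀ E₁₀ : Matrix μ μ ℝ} (hE0' : Matrix.of (E 0) = E₀) (hE10 : Matrix.of (E₁ 0) = E₁₀)
    -- non-degeneracy at `0`
    (hT : (τ₁ * X₀).det ≠ 0) (hTc : (τ₂ * DW₀).det ≠ 0) (hS : (P * Wc₀).det ≠ 0)
    (h1 : (kkt K₀ (fromRows Q₀ τ₁)).det ≠ 0) (h2 : (kkt E₀ (fromRows R₀ τ₂)).det ≠ 0) :
    (1 : ℝ) * secondVar (kkt K₀ (fromRows NQ₀ P)) (kkt K₁₀ (fromRows NQ₁₀ (0 : Matrix (ρ₂ ⊕ ρ₁) ν ℝ)))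
          (kkt K₂ (fromRows NQ'' (0 : Matrix (ρ₂ ⊕ ρ₁) ν ℝ)))
      + (-2 : ℝ) * secondVar (P * Wc₀) (P * Wc₁₀) (P * Wc'')
      + (-1 : ℝ) * secondVar (kkt K₀ (fromRows Q₀ τ₁)) (kkt K₁₀ (fromRows Q₁₀ (0 : Matrix ρ₁ ν ℝ))) (kkt K₂ (fromRows Q'' (0 : Matrix ρ₁ ν ℝ)))
      + (2 : ℝ) * secondVar (τ₁ * X₀) (τ₁ * X₁₀) (τ₁ * X'')
      + (-1 : ℝ) * secondVar (kkt E₀ (fromRows R₀ τ₂)) (kkt E₁₀ (fromRows R₁₀ (0 : Matrix ρ₂ μ ℝ))) (kkt E₂ (fromRows R'' (0 : Matrix ρ₂ μ ℝ)))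
      + (2 : ℝ) * secondVar (τ₂ * DW₀) (τ₂ * DW₁₀) (τ₂ * DW'') = 0 := by
  subst hK0 hK10 hQ0 hQ10 hR0 hR10 hX0 hX10 hNQ0' hNQ10 hDW0' hDW10 hWc0' hWc10 hE0' hE10
  -- first jets read as matrices
  have hK' : ∀ᶠ u in 𝓝 (0 : ℝ), HasDerivAt K (Matrix.of.symm (Matrix.of (K₁ u))) u := hK
  have hQm : ∀ᶠ u in 𝓝 (0 : ℝ), HasDerivAt Q (Matrix.of.symm (Matrix.of (Q' u))) u := hQ
  have hRm : ∀ᶠ u in 𝓝 (0 : ℝ), HasDerivAt R (Matrix.of.symm (Matrix.of (R' u))) u := hR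
  have hXm : ∀ᶠ u in 𝓝 (0 : ℝ), HasDerivAt X (Matrix.of.symm (Matrix.of (X' u))) u := hX
  have hNQm : ∀ᶠ u in 𝓝 (0 : ℝ), HasDerivAt NQ (Matrix.of.symm (Matrix.of (NQ' u))) u := hNQ
  have hDWm : ∀ᶠ u in 𝓝 (0 : ℝ), HasDerivAt DW (Matrix.of.symm (Matrix.of (DW' u))) u := hDW
  have hWcm : ∀ᶠ u in 𝓝 (0 : ℝ), HasDerivAt Wc (Matrix.of.symm (Matrix.of (Wc' u))) u := hWc
  have hEm : ∀ᶠ u in 𝓝 (0 : ℝ), HasDerivAt E (Matrix.of.symm (Matrix.of (E₁ u))) u := hE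
  have h0ρ : ∀ u : ℝ, HasDerivAt (fun _ : ℝ => Matrix.of.symm τ₁) (Matrix.of.symm (0 : Matrix ρ₁ ν ℝ)) u := fun u => by
    have h := hasDerivAt_const u (Matrix.of.symm τ₁); exact h
  have h0κ : ∀ u : ℝ, HasDerivAt (fun _ : ℝ => Matrix.of.symm τ₂) (Matrix.of.symm (0 : Matrix ρ₂ μ ℝ)) u := fun u => by
    have h := hasDerivAt_const u (Matrix.of.symm τ₂); exact h
  have h0P : ∀ u : ℝ, HasDerivAt (fun _ : ℝ => Matrix.of.symm P) (Matrix.of.symm (0 : Matrix (ρ₂ ⊕ ρ₁) ν ℝ)) u := fun u => by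
    have h := hasDerivAt_const u (Matrix.of.symm P); exact h
  have h00ρ : HasDerivAt (fun _ : ℝ => Matrix.of.symm (0 : Matrix ρ₁ ν ℝ)) (Matrix.of.symm (0 : Matrix ρ₁ ν ℝ)) 0 := by
    have h := hasDerivAt_const (0 : ℝ) (Matrix.of.symm (0 : Matrix ρ₁ ν ℝ)); exact h
  have h00κ : HasDerivAt (fun _ : ℝ => Matrix.of.symm (0 : Matrix ρ₂ μ ℝ)) (Matrix.of.symm (0 : Matrix ρ₂ μ ℝ)) 0 := by
    have h := hasDerivAt_const (0 : ℝ) (Matrix.of.symm (0 : Matrix ρ₂ μ ℝ)); exact h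
  have h00P : HasDerivAt (fun _ : ℝ => Matrix.of.symm (0 : Matrix (ρ₂ ⊕ ρ₁) ν ℝ)) (Matrix.of.symm (0 : Matrix (ρ₂ ⊕ ρ₁) ν ℝ)) 0 := by
    have h := hasDerivAt_const (0 : ℝ) (Matrix.of.symm (0 : Matrix (ρ₂ ⊕ ρ₁) ν ℝ)); exact h
  -- (N) the one-shot bordered curve `kkt K [NQ; P]`
  have hNd : ∀ᶠ u in 𝓝 (0 : ℝ), HasDerivAt (fun u => Matrix.of.symm (kkt (Matrix.of (K u)) (fromRows (Matrix.of (NQ u)) P)))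
      ((fun u => Matrix.of.symm (kkt (Matrix.of (K₁ u)) (fromRows (Matrix.of (NQ' u)) (0 : Matrix (ρ₂ ⊕ ρ₁) ν ℝ)))) u) u := by
    filter_upwards [hK', hNQm] with u huK huN
    exact hasDerivAt_kkt_fromRows (T := fun _ => Matrix.of.symm P) huK huN (h0P u)
  have hN₁d : HasDerivAt (fun u => Matrix.of.symm (kkt (Matrix.of (K₁ u)) (fromRows (Matrix.of (NQ' u)) (0 : Matrix (ρ₂ ⊕ ρ₁) ν ℝ))))
      (Matrix.of.symm (kkt K₂ (fromRows NQ'' (0 : Matrix (ρ₂ ⊕ ρ₁) ν ℝ)))) 0 :=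
    hasDerivAt_kkt_fromRows (T := fun _ => Matrix.of.symm (0 : Matrix (ρ₂ ⊕ ρ₁) ν ℝ)) hK₁ hNQ' h00P
  -- (G) the one-shot FP curve `P·Wc`
  have hGd : ∀ᶠ u in 𝓝 (0 : ℝ), HasDerivAt (fun u => Matrix.of.symm (P * Matrix.of (Wc u)))
      ((fun u => Matrix.of.symm (P * Matrix.of (Wc' u))) u) u := by
    filter_upwards [hWcm] with u hu
    exact hasDerivAt_const_mul P hu
  have hG₁d : HasDerivAt (fun u => Matrix.of.symm (P * Matrix.of (Wc' u))) (Matrix.of.symm (P * Wc'')) 0 := hasDerivAt_const_mul P hWc'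
  -- (F) the fine bordered curve `kkt K [Q; τ₁]`
  have hFd : ∀ᶠ u in 𝓝 (0 : ℝ), HasDerivAt (fun u => Matrix.of.symm (kkt (Matrix.of (K u)) (fromRows (Matrix.of (Q u)) τ₁)))
      ((fun u => Matrix.of.symm (kkt (Matrix.of (K₁ u)) (fromRows (Matrix.of (Q' u)) (0 : Matrix ρ₁ ν ℝ)))) u) u := by
    filter_upwards [hK', hQm] with u huK huQ
    exact hasDerivAt_kkt_fromRows (T := fun _ => Matrix.of.symm τ₁) huK huQ (h0ρ u)
  have hF₁d : HasDerivAt (fun u => Matrix.of.symm (kkt (Matrix.of (K₁ u)) (fromRows (Matrix.of (Q' u)) (0 : Matrix ρ₁ ν ℝ))))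
      (Matrix.of.symm (kkt K₂ (fromRows Q'' (0 : Matrix ρ₁ ν ℝ)))) 0 :=
    hasDerivAt_kkt_fromRows (T := fun _ => Matrix.of.symm (0 : Matrix ρ₁ ν ℝ)) hK₁ hQ' h00ρ
  -- (T) the fine FP curve `τ₁·X`
  have hTd : ∀ᶠ u in 𝓝 (0 : ℝ), HasDerivAt (fun u => Matrix.of.symm (τ₁ * Matrix.of (X u)))
      ((fun u => Matrix.of.symm (τ₁ * Matrix.of (X' u))) u) u := by
    filter_upwards [hXm] with u hu
    exact hasDerivAt_const_mul τ₁ hu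
  have hT₁d : HasDerivAt (fun u => Matrix.of.symm (τ₁ * Matrix.of (X' u))) (Matrix.of.symm (τ₁ * X'')) 0 := hasDerivAt_const_mul τ₁ hX'
  -- (B) the block bordered curve `kkt E [R; τ₂]`
  have hBd : ∀ᶠ u in 𝓝 (0 : ℝ), HasDerivAt (fun u => Matrix.of.symm (kkt (Matrix.of (E u)) (fromRows (Matrix.of (R u)) τ₂)))
      ((fun u => Matrix.of.symm (kkt (Matrix.of (E₁ u)) (fromRows (Matrix.of (R' u)) (0 : Matrix ρ₂ μ ℝ)))) u) u := by
    filter_upwards [hEm, hRm] with u huE huR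
    exact hasDerivAt_kkt_fromRows (T := fun _ => Matrix.of.symm τ₂) huE huR (h0κ u)
  have hB₁d : HasDerivAt (fun u => Matrix.of.symm (kkt (Matrix.of (E₁ u)) (fromRows (Matrix.of (R' u)) (0 : Matrix ρ₂ μ ℝ))))
      (Matrix.of.symm (kkt E₂ (fromRows R'' (0 : Matrix ρ₂ μ ℝ)))) 0 :=
    hasDerivAt_kkt_fromRows (T := fun _ => Matrix.of.symm (0 : Matrix ρ₂ μ ℝ)) hE₁ hR' h00κ
  -- (U) the block FP curve `τ₂·DW`
  have hUd : ∀ᶠ u in 𝓝 (0 : ℝ), HasDerivAt (fun u => Matrix.of.symm (τ₂ * Matrix.of (DW u)))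
      ((fun u => Matrix.of.symm (τ₂ * Matrix.of (DW' u))) u) u := by
    filter_upwards [hDWm] with u hu
    exact hasDerivAt_const_mul τ₂ hu
  have hU₁d : HasDerivAt (fun u => Matrix.of.symm (τ₂ * Matrix.of (DW' u))) (Matrix.of.symm (τ₂ * DW'')) 0 := hasDerivAt_const_mul τ₂ hDW'
  -- non-degeneracy at `0` of the one shot, and persistence near `0` of the five others
  have hNQ0 : Matrix.of (NQ 0) = Matrix.of (R 0) * Matrix.of (Q 0) := hNQeq.self_of_nhds
  have hDW0 : Matrix.of (DW 0) = Matrix.of (Q 0) * Matrix.of (Y 0) := hDWeq.self_of_nhds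
  have hWc0 : Matrix.of (Wc 0) = fromCols (Matrix.of (Y 0)) (Matrix.of (X 0)) := hWceq.self_of_nhds
  have hE0 : Matrix.of (E 0) = (effForm (Matrix.of (K 0)) (fromRows (Matrix.of (Q 0)) τ₁)).toBlocks₁₁ := hEeq.self_of_nhds
  have hN0 : (kkt (Matrix.of (K 0)) (fromRows (Matrix.of (NQ 0)) P)).det ≠ 0 := by
    rw [hNQ0]
    refine det_kkt_oneShot_ne_zero (Matrix.of (K 0)) (Matrix.of (Q 0)) τ₁ (Matrix.of (X 0)) (Matrix.of (R 0)) τ₂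
      hKX.self_of_nhds hKtX.self_of_nhds hQX.self_of_nhds (isUnit_iff_ne_zero.mpr hT) (isUnit_iff_ne_zero.mpr h1) ?_
      (Matrix.of (Y 0)) hKY.self_of_nhds hKtY.self_of_nhds hRQY.self_of_nhds ?_ P ?_
    · rw [← hE0]; exact isUnit_iff_ne_zero.mpr h2
    · rw [← hDW0]; exact isUnit_iff_ne_zero.mpr hTc
    · rw [← hWc0]; exact isUnit_iff_ne_zero.mpr hS
  have hGne : ∀ᶠ u in 𝓝 (0 : ℝ), (Matrix.of (Matrix.of.symm (P * Matrix.of (Wc u)))).det ≠ 0 :=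
    eventually_det_ne_zero (hGd.self_of_nhds).hasFDerivAt hS
  have hFne : ∀ᶠ u in 𝓝 (0 : ℝ), (Matrix.of (Matrix.of.symm (kkt (Matrix.of (K u)) (fromRows (Matrix.of (Q u)) τ₁)))).det ≠ 0 :=
    eventually_det_ne_zero (hFd.self_of_nhds).hasFDerivAt h1
  have hTne : ∀ᶠ u in 𝓝 (0 : ℝ), (Matrix.of (Matrix.of.symm (τ₁ * Matrix.of (X u)))).det ≠ 0 :=
    eventually_det_ne_zero (hTd.self_of_nhds).hasFDerivAt hT
  have hBne : ∀ᶠ u in 𝓝 (0 : ℝ), (Matrix.of (Matrix.of.symm (kkt (Matrix.of (E u)) (fromRows (Matrix.of (R u)) τ₂)))).det ≠ 0 :=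
    eventually_det_ne_zero (hBd.self_of_nhds).hasFDerivAt h2
  have hUne : ∀ᶠ u in 𝓝 (0 : ℝ), (Matrix.of (Matrix.of.symm (τ₂ * Matrix.of (DW u)))).det ≠ 0 :=
    eventually_det_ne_zero (hUd.self_of_nhds).hasFDerivAt hTc
  -- the `log|det|` identity near `0`
  have heq : ∀ᶠ u in 𝓝 (0 : ℝ),
      (1 : ℝ) * Real.log |(Matrix.of (Matrix.of.symm (kkt (Matrix.of (K u)) (fromRows (Matrix.of (NQ u)) P)))).det|
        + (-2 : ℝ) * Real.log |(Matrix.of (Matrix.of.symm (P * Matrix.of (Wc u)))).det|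
        + (-1 : ℝ) * Real.log |(Matrix.of (Matrix.of.symm (kkt (Matrix.of (K u)) (fromRows (Matrix.of (Q u)) τ₁)))).det|
        + (2 : ℝ) * Real.log |(Matrix.of (Matrix.of.symm (τ₁ * Matrix.of (X u)))).det|
        + (-1 : ℝ) * Real.log |(Matrix.of (Matrix.of.symm (kkt (Matrix.of (E u)) (fromRows (Matrix.of (R u)) τ₂)))).det|
        + (2 : ℝ) * Real.log |(Matrix.of (Matrix.of.symm (τ₂ * Matrix.of (DW u)))).det| = 0 := by
    filter_upwards [hGne, hFne, hTne, hBne, hUne, hNQeq, hDWeq, hWceq, hEeq, hKX, hKtX, hQX, hKY, hKtY, hRQY]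
      with u huG huF huT huB huU huNQ huDW huWc huE huKX huKtX huQX huKY huKtY huRQY
    have huG' : IsUnit (P * fromCols (Matrix.of (Y u)) (Matrix.of (X u))).det := by
      rw [← huWc]; exact isUnit_iff_ne_zero.mpr huG
    have huF' : IsUnit (kkt (Matrix.of (K u)) (fromRows (Matrix.of (Q u)) τ₁)).det := isUnit_iff_ne_zero.mpr huF
    have huT' : IsUnit (τ₁ * Matrix.of (X u)).det := isUnit_iff_ne_zero.mpr huT
    have huB' : IsUnit (kkt (effForm (Matrix.of (K u)) (fromRows (Matrix.of (Q u)) τ₁)).toBlocks₁₁ (fromRows (Matrix.of (R u)) τ₂)).det := by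
      rw [← huE]; exact isUnit_iff_ne_zero.mpr huB
    have huU' : IsUnit (τ₂ * (Matrix.of (Q u) * Matrix.of (Y u))).det := by
      rw [← huDW]; exact isUnit_iff_ne_zero.mpr huU
    have hlog := log_abs_det_kkt_comp_ghostDressed (Matrix.of (K u)) (Matrix.of (Q u)) τ₁ (Matrix.of (X u)) (Matrix.of (R u)) τ₂
      huKX huKtX huQX huT' huF' huB' (Matrix.of (Y u)) huKY huKtY huRQY huU' P huG'
    rw [← huNQ, ← huWc, ← huE, ← huDW] at hlog
    show (1 : ℝ) * Real.log |(kkt (Matrix.of (K u)) (fromRows (Matrix.of (NQ u)) P)).det|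
        + (-2 : ℝ) * Real.log |(P * Matrix.of (Wc u)).det|
        + (-1 : ℝ) * Real.log |(kkt (Matrix.of (K u)) (fromRows (Matrix.of (Q u)) τ₁)).det|
        + (2 : ℝ) * Real.log |(τ₁ * Matrix.of (X u)).det|
        + (-1 : ℝ) * Real.log |(kkt (Matrix.of (E u)) (fromRows (Matrix.of (R u)) τ₂)).det|
        + (2 : ℝ) * Real.log |(τ₂ * Matrix.of (DW u)).det| = 0
    linarith
  -- differentiate twice
  have hmain := secondVar_comb6_eq_zero (a := 1) (b := -2) (c := -1) (d := 2) (g := -1) (h := 2) (k := 0) (t := 0)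
    hNd hN₁d hN0 hGd hG₁d hS hFd hF₁d h1 hTd hT₁d hT hBd hB₁d h2 hUd hU₁d hTc heq
  simp only [Equiv.apply_symm_apply] at hmain
  exact hmain

end Moving

end Summit.QuantumFields.BalabanUV.Beta.FP.GhostAwareStepLawHessian

end
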